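import Summits.BirchSwinnertonDyer.BirchSwinnertonDyer.Theorems.ManinLocalTwoThreePinningKernelStaged
import Summits.BirchSwinnertonDyer.BirchSwinnertonDyer.Theorems.ManinLocalTwoThreePinningKernelCusp
import Summits.BirchSwinnertonDyer.BirchSwinnertonDyer.Theorems.ManinLocalTwoThreePinningNinetyNineTables
import Literature.NumberTheory.EllipticCurves.ModularFormsGamma0WeightTwoDimension
import HarnessLib

/-!
# LEVEL 99 (genus 9) by the PINNING KERNEL IN `S₂` WITH A HECKE/TWIST-CLOSURE BASIS: THE NEWFORM OF EVERY `X₀(99)`-DATUM, FACT-FREE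

Cell `bsd-f2-manin`, route `ManinLocalTwoThree`, crux C3 `ManinPrimeToThreeAtNine` (stmt-BirchSwinnertonDyer-22968, `9 ∣ 99`), an g59
(LENS analytic/periods); `--supports stmt-BirchSwinnertonDyer-22967` (helper, the route's pinning series).  INSTANCE of
`…PinningKernel{Sieve,,Staged,Cusp,Hecke}`: part B's abstract kernel `exists_smul_eq_sum_of_certs` run in `V = S₂(Γ₀(99))`
(`coef = cuspCoeffₗ`, `dim = g = 9`) on the basis of part 1 (`…PinningNinetyNineTables`): the 6 cuspidal `η`-quotient seeds
`h0 … h5` closed under the `χ· = (·/3)`-twist ALONE (no Hecke operator is needed at this level) — `h0, h1, h2, h3, h4, h5, χ·h0, χ·h3, χ·h5`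
(`basis`; `h0 = η₁²η₁₁² = φ₁₁`, `h1 = φ₁₁(3τ)`, `h2 = φ₁₁(9τ)`, `h3 = η₁η₃η₁₁η₃₃`, `h4 = h3(3τ)`, `h5 = η₃⁴η₃₃⁴/(η₁η₉η₁₁η₉₉)`).
WHY A NEW BASIS: the cuspidal `η`-quotients of level 99 are 6 in number (`g = 9`), the holomorphic ones do not span `M₂` either, and the
levels `99/3, 99/9` carry no weight-2 `η`-quotients at all — the `η`-kernel of the levels `120 … 400` has no pool here; the Hecke/twist
closure of the seeds has full rank 9 already at depth 48 (an g58 `heckeclose.py`, run by an g59 with `OPS=X3`).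
THE RESULT.  The seed tables are certified to depth 48 (sparse `η` certificates), the 9 basis tables to depth 48 follow by part H
(`table_twist3`, `table_mono`) from decidable list identities, the integer duals have `d = 12`; the staged box sieve over
`3, 2, 11, 13, 5, 7` (`a₃ = 0` forced by `9 ∣ 99`) with the certified column relations leaves exactly 6 prime assignments (`certs`):
the 4 rational newform classes `99a`, `99b`, `99c`, `99d` and the `3`-depleted coefficient systems of the old classes
`11a`, `33a` (consistent with every linear relation of `S₂(Γ₀(99))`, realised by no datum since `a₃(D.f) = 0 ≠ a₃`
of those classes; harmless: a consumer reads its class off `truth W`).  **`pinning_cusp (D)`**: for every `X₀(99)`-datum `D` of an elliptic `W/ℚ`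
there are the seed cusp forms `S` (values = the `η`-quotients of `Ls`) and a certificate `(σ, d′, y) ∈ certs` with `truth W = σ` and
`d′ • D.f = Σ_j y_j • basis S j` in `S₂(Γ₀(99))`; here every `d′ = 1`.
HONEST FRAMING: unconditional, standard axioms; no newness/eigen statement about the basis is claimed; the Néron/`c`-side at `99` is NOT
touched; the row a consumer wants for `99d = 11a ⊗ χ₋₃` reads `D.f = χ·(S 0)` with `S 0 = η₁²η₁₁²` (the certificate `y = e₆`), `99c` lies in
the plain `η`-span, `99a`/`99b` need the twists `χ·h3`, `χ·h5`; nothing here proves C2/C3, Manin's conjecture or BSD.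
[cite: CremonaAlgorithms1997, §2.10, Table 1 (99a, 99b, 99c, 99d)] [cite: AtkinLehner1970, Thm. 3] [cite: DiamondShurman2005, Thm. 3.5.1, Prop. 5.2.2(a)]
[cite: Shimura1971, Prop. 3.64] [cite: Koehler2011, §2.1] [cite: Ligozat1975, Ch. 3]
-/

set_option autoImplicit false
-- lint-debt: the directory name repeats the summit name (sibling precedent `ManinLocalTwoThreePinningSixtyThree.lean`)
set_option linter.dupNamespace false

noncomputable section


open Complex
open UpperHalfPlane hiding I
open scoped MatrixGroups ModularForm
open ModularForm CongruenceSubgroup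
open Literature.NumberTheory.ModularForms
open Literature.NumberTheory.EllipticCurves Literature.NumberTheory.EllipticCurves.ModularForms

namespace Summit.BirchSwinnertonDyer.BirchSwinnertonDyer.Theorems.ManinLocalTwoThree.PinningNinetyNine

open Summit.BirchSwinnertonDyer.BirchSwinnertonDyer.Theorems.ManinLocalTwoThree.BracketSturm
open Summit.BirchSwinnertonDyer.BirchSwinnertonDyer.Theorems.ManinLocalTwoThree.PinningKernel


set_option maxHeartbeats 4000000
set_option maxRecDepth 16384

/-! ## §3 Duals, relations, the staged sieve -/

/-- **The dual certificate** `⟨dualsᵢ, tabsⱼ⟩ = 12·δᵢⱼ`. [folklore] -/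
theorem hdual : ∀ i j : Fin 9, dotList (duals i) (tabs j) = if i = j then (12 : ℤ) else 0 := by
  decide +kernel

/-- The dual vectors live below depth `48`. [folklore] -/
theorem hlen : ∀ i : Fin 9, (duals i).length ≤ 48 := by
  decide +kernel

/-- **The relation certificate**: every stage relation is a column relation of the tables. [folklore] -/
theorem hrel : ∀ st ∈ stages, ∀ v ∈ st.2, v.length ≤ 48 ∧ ∀ j : Fin 9, dotList v (tabs j) = 0 := by
  decide +kernel

/-- Sieve stage `0`: the live list `L_0` is mapped into `L_1` (kernel `decide`). [folklore] -/
theorem hst0 : ∀ σ ∈ sieveStep 99 48 ((([[]] : List (List (ℕ × ℤ))) :: lvs).getD 0 []) (stages.getD 0 (0, [])), σ ∈ lvs.getD 0 [] := by decide +kernel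
/-- Sieve stage `1`: the live list `L_1` is mapped into `L_2` (kernel `decide`). [folklore] -/
theorem hst1 : ∀ σ ∈ sieveStep 99 48 ((([[]] : List (List (ℕ × ℤ))) :: lvs).getD 1 []) (stages.getD 1 (0, [])), σ ∈ lvs.getD 1 [] := by decide +kernel
/-- Sieve stage `2`: the live list `L_2` is mapped into `L_3` (kernel `decide`). [folklore] -/
theorem hst2 : ∀ σ ∈ sieveStep 99 48 ((([[]] : List (List (ℕ × ℤ))) :: lvs).getD 2 []) (stages.getD 2 (0, [])), σ ∈ lvs.getD 2 [] := by decide +kernel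
/-- Sieve stage `3`: the live list `L_3` is mapped into `L_4` (kernel `decide`). [folklore] -/
theorem hst3 : ∀ σ ∈ sieveStep 99 48 ((([[]] : List (List (ℕ × ℤ))) :: lvs).getD 3 []) (stages.getD 3 (0, [])), σ ∈ lvs.getD 3 [] := by decide +kernel
/-- Sieve stage `4`: the live list `L_4` is mapped into `L_5` (kernel `decide`). [folklore] -/
theorem hst4 : ∀ σ ∈ sieveStep 99 48 ((([[]] : List (List (ℕ × ℤ))) :: lvs).getD 4 []) (stages.getD 4 (0, [])), σ ∈ lvs.getD 4 [] := by decide +kernel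
/-- Sieve stage `5`: the live list `L_5` is mapped into `L_6` (kernel `decide`). [folklore] -/
theorem hst5 : ∀ σ ∈ sieveStep 99 48 ((([[]] : List (List (ℕ × ℤ))) :: lvs).getD 5 []) (stages.getD 5 (0, [])), σ ∈ lvs.getD 5 [] := by decide +kernel

/-- **THE SIEVE**, certified one stage at a time (`hst0 … hst5`), assembled by `PinningKernel.runSieve_subset_of_chain`
(part D `…PinningKernelStaged`): the staged box sieve returns only assignments listed in `certs`. [cite: CremonaAlgorithms1997, §2.10] -/
theorem hcover : ∀ σ ∈ runSieve 99 48 stages, σ ∈ certs.map Prod.fst := by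
  have hch : ∀ k < stages.length, ∀ σ ∈ sieveStep 99 48 ((([[]] : List (List (ℕ × ℤ))) :: lvs).getD k [])
      (stages.getD k (0, [])), σ ∈ lvs.getD k [] := by
    intro k hk
    have hk' : k < 6 := lt_of_lt_of_eq hk (by decide)
    interval_cases k
    exacts [hst0, hst1, hst2, hst3, hst4, hst5]
  have hlast : ((([[]] : List (List (ℕ × ℤ))) :: lvs).getD stages.length []) = certs.map Prod.fst := by decide +kernel
  exact fun σ hσ ↦ hlast ▸ runSieve_subset_of_chain 99 48 stages lvs (by decide) hch σ hσ

/-- **The coordinate certificates** `d'·aₙ(σ) = Σ_j y_j·tabsⱼ[n]` on the dual support. [folklore] -/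
theorem hpiv : ∀ c ∈ certs, ∀ i : Fin 9, ∀ n < (duals i).length, (duals i).getD n 0 ≠ 0 →
    (evalOpt 99 c.1 n).map (fun x ↦ c.2.1 * x) = some (∑ j : Fin 9, c.2.2.getD (j : ℕ) 0 * (tabs j).getD n 0) := by
  decide +kernel

/-- The stage primes are prime (stated with the level's prime list spelled out, so that the statement is level-specific;
sibling precedent: the inlined `hps` of `…PinningOneFortyFour`). [folklore] -/
theorem hps99 : ∀ st ∈ stages, st.1 ∈ [3, 2, 11, 13, 5, 7] ∧ st.1.Prime := by
  intro st hst
  have h : st.1 ∈ stages.map Prod.fst := List.mem_map.mpr ⟨st, hst, rfl⟩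
  have hl : stages.map Prod.fst = [3, 2, 11, 13, 5, 7] := by decide
  rw [hl] at h
  refine ⟨h, ?_⟩
  simp only [List.mem_cons, List.mem_nil_iff, or_false] at h
  rcases h with h | h | h | h | h | h <;> rw [h] <;> norm_num

/-! ## §4 `dim S₂(Γ₀(99)) = 9` -/

/-- `μ(Γ₀(99)) = 144`, `ν_∞ = 8`, `ν₂ = ν₃ = 0`. [cite: DiamondShurman2005, §3.8] -/
theorem gamma0_data : gamma0Index 99 = 144 ∧ nuInfty 99 = 8 ∧ nu₂ 99 = 0 ∧ nu₃ 99 = 0 := by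
  refine ⟨?_, by decide, by rw [nu₂_eq_card]; decide, by rw [nu₃_eq_card]; decide⟩
  · rw [(gamma0Index_mul (m := 9) (n := 11) (by norm_num)),
      show (9 : ℕ) = 3 ^ 2 by norm_num, gamma0Index_prime_pow (p := 3) (e := 2) Nat.prime_three (by norm_num),
      gamma0Index_prime (by norm_num : Nat.Prime 11)]
    norm_num

/-- **`dim S₂(Γ₀(99)) = 9`** (the genus; `μ = 144`, `ν_∞ = 8`), by the tree's `finrank_cuspForm_two_eq_genusX0_holds`.
[cite: DiamondShurman2005, Thm. 3.5.1] -/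
theorem finrank_cuspForm_two : Module.finrank ℂ (CuspForm (Gamma0 99) 2) = 9 := by
  obtain ⟨h1, h2, h3, h4⟩ := gamma0_data
  have h : Module.finrank ℂ (CuspForm (Gamma0 99) 2) = genusX0 99 := finrank_cuspForm_two_eq_genusX0_holds 99
  rw [h, genusX0, h1, h2, h3, h4]

/-! ## §5 The basis: the seeds closed under the `(·/3)`-twist; its certified tables -/

/-- The `(·/3)`-twist on `S₂(Γ₀(99))` (`9 ∣ 99`; tree `charTwist`, same level). [cite: Shimura1971, Prop. 3.64] -/
def X (f : CuspForm (Gamma0 99) 2) : CuspForm (Gamma0 99) 2 :=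
  charTwist 99 dvd_rfl (by norm_num : 3 ^ 2 ∣ 99) (isQuadratic_quadraticChar_ringHomComp 3) f

/-- **The basis** as words in `χ·` applied to the seeds `S 0 … S 5`: `h0, h1, h2, h3, h4, h5, χ·h0, χ·h3, χ·h5`. [folklore] -/
def basis (S : Fin 6 → CuspForm (Gamma0 99) 2) : Fin 9 → CuspForm (Gamma0 99) 2 :=
  ![S 0, S 1, S 2, S 3, S 4, S 5, X (S 0), X (S 3), X (S 5)]

section Tables

variable (S : Fin 6 → CuspForm (Gamma0 99) 2) (hs : ∀ i, ∀ m < 48, (((stabs i).getD m 0 : ℤ) : ℂ) = cuspCoeff (S i) m)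
include hs

/-- Certified table of basis form `0` = `h0`. [folklore] -/
theorem hb0 : ∀ n < 48, (((tabs 0).getD n 0 : ℤ) : ℂ) = cuspCoeff (S 0) n :=
  table_mono (fun n (F : CuspForm (Gamma0 99) 2) ↦ cuspCoeff F n) (by norm_num : 48 ≤ 48) (S 0) (stabs 0) (tabs 0) (hs 0) hder0
/-- Certified table of basis form `1` = `h1`. [folklore] -/
theorem hb1 : ∀ n < 48, (((tabs 1).getD n 0 : ℤ) : ℂ) = cuspCoeff (S 1) n :=
  table_mono (fun n (F : CuspForm (Gamma0 99) 2) ↦ cuspCoeff F n) (by norm_num : 48 ≤ 48) (S 1) (stabs 1) (tabs 1) (hs 1) hder1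
/-- Certified table of basis form `2` = `h2`. [folklore] -/
theorem hb2 : ∀ n < 48, (((tabs 2).getD n 0 : ℤ) : ℂ) = cuspCoeff (S 2) n :=
  table_mono (fun n (F : CuspForm (Gamma0 99) 2) ↦ cuspCoeff F n) (by norm_num : 48 ≤ 48) (S 2) (stabs 2) (tabs 2) (hs 2) hder2
/-- Certified table of basis form `3` = `h3`. [folklore] -/
theorem hb3 : ∀ n < 48, (((tabs 3).getD n 0 : ℤ) : ℂ) = cuspCoeff (S 3) n :=
  table_mono (fun n (F : CuspForm (Gamma0 99) 2) ↦ cuspCoeff F n) (by norm_num : 48 ≤ 48) (S 3) (stabs 3) (tabs 3) (hs 3) hder3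
/-- Certified table of basis form `4` = `h4`. [folklore] -/
theorem hb4 : ∀ n < 48, (((tabs 4).getD n 0 : ℤ) : ℂ) = cuspCoeff (S 4) n :=
  table_mono (fun n (F : CuspForm (Gamma0 99) 2) ↦ cuspCoeff F n) (by norm_num : 48 ≤ 48) (S 4) (stabs 4) (tabs 4) (hs 4) hder4
/-- Certified table of basis form `5` = `h5`. [folklore] -/
theorem hb5 : ∀ n < 48, (((tabs 5).getD n 0 : ℤ) : ℂ) = cuspCoeff (S 5) n :=
  table_mono (fun n (F : CuspForm (Gamma0 99) 2) ↦ cuspCoeff F n) (by norm_num : 48 ≤ 48) (S 5) (stabs 5) (tabs 5) (hs 5) hder5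
/-- Certified table of basis form `6` = `χ·h0`. [folklore] -/
theorem hb6 : ∀ n < 48, (((tabs 6).getD n 0 : ℤ) : ℂ) = cuspCoeff (X (S 0)) n :=
  table_twist3 (by norm_num : 3 ^ 2 ∣ 99) 48 (S 0) (tabs 0) (tabs 6) (hb0 S hs) hder6
/-- Certified table of basis form `7` = `χ·h3`. [folklore] -/
theorem hb7 : ∀ n < 48, (((tabs 7).getD n 0 : ℤ) : ℂ) = cuspCoeff (X (S 3)) n :=
  table_twist3 (by norm_num : 3 ^ 2 ∣ 99) 48 (S 3) (tabs 3) (tabs 7) (hb3 S hs) hder7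
/-- Certified table of basis form `8` = `χ·h5`. [folklore] -/
theorem hb8 : ∀ n < 48, (((tabs 8).getD n 0 : ℤ) : ℂ) = cuspCoeff (X (S 5)) n :=
  table_twist3 (by norm_num : 3 ^ 2 ∣ 99) 48 (S 5) (tabs 5) (tabs 8) (hb5 S hs) hder8

/-- **The certified tables of the basis** in the coefficient functionals of `S₂(Γ₀(99))`. [folklore] -/
theorem htabs : ∀ j : Fin 9, ∀ n < 48,
    (((tabs j).getD n 0 : ℤ) : ℂ) = cuspCoeffₗ (one_mem_strictPeriods_coe_gamma0 99) n (basis S j) := by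
  intro j; fin_cases j <;> intro n hn <;> rw [cuspCoeffₗ_apply]
  exacts [hb0 S hs n hn, hb1 S hs n hn, hb2 S hs n hn, hb3 S hs n hn, hb4 S hs n hn, hb5 S hs n hn, hb6 S hs n hn, hb7 S hs n hn, hb8 S hs n hn]

end Tables

/-! ## §6 The pinning (6 certificates; kernel in `S₂(Γ₀(99))`) -/

/-- **LEVEL 99 PINNED IN `S₂(Γ₀(99))`.**  For every `X₀(99)`-datum `D` of an elliptic `W/ℚ`: with the seed cusp forms `S` (the 6 cuspidal
`η`-quotients of `Ls`) and the basis `basis S` (their closure under the `(·/3)`-twist), for some certificate `c = (σ, d', y) ∈ certs`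
the sieve truth of `W` over `3, 2, 11, 13, 5, 7` is `σ` and `d' • D.f = Σ_j y_j • basis S j` (all `d' = 1`: `D.f` is an INTEGER combination).
[cite: CremonaAlgorithms1997, §2.10, Table 1 (99a, 99b, 99c, 99d)] [cite: AtkinLehner1970, Thm. 3] -/
theorem pinning_cusp {W : WeierstrassCurve ℚ} [W.IsElliptic] (D : ModularParametrizationData W 99) :
    ∃ S : Fin 6 → CuspForm (Gamma0 99) 2, (∀ i, ∀ τ : ℍ, S i τ = etaQuotient 99 (expFn (Ls[(i : ℕ)]).1) τ) ∧
      ∃ c ∈ certs, truth W (stages.map Prod.fst) = c.1 ∧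
        ((c.2.1 : ℤ) : ℂ) • D.f = ∑ j : Fin 9, ((c.2.2.getD (j : ℕ) 0 : ℤ) : ℂ) • basis S j := by
  obtain ⟨S, hS⟩ := exists_etaCuspForms 99 Ls hcusp
  obtain ⟨C, hCS⟩ : ∃ C : Fin 6 → ModularForm (Gamma0 99) 2, ∀ i, ModularFormClass.modularForm (S i) = C i :=
    ⟨_, fun _ ↦ rfl⟩
  have hC : ∀ i, ∀ τ : ℍ, C i τ = etaQuotient 99 (expFn (Ls[(i : ℕ)]).1) τ := fun i τ ↦ by rw [← hCS]; exact hS i τ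
  have ht := tables_of_etaCertsSparse 99 48 (fun i : Fin 6 ↦ expFn (Ls[(i : ℕ)]).1) (fun i ↦ shifts i) stabs C hC hshift hcert
  have hs : ∀ i, ∀ m < 48, (((stabs i).getD m 0 : ℤ) : ℂ) = cuspCoeff (S i) m :=
    fun i m hm ↦ by rw [← modCoefₗ_modularForm (S i) m, hCS]; exact ht i m hm
  haveI : FiniteDimensional ℂ (CuspForm (Gamma0 99) 2) := finiteDimensional_cuspForm_gamma0 99 2
  have hF : ∀ n, cuspCoeffₗ (one_mem_strictPeriods_coe_gamma0 99) n D.f = ((W.LFunction n : ℤ) : ℂ) :=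
    fun n ↦ by rw [cuspCoeffₗ_apply]; exact D.isNewformOf.2 n
  obtain ⟨c, hc, hc1, hpin⟩ := exists_smul_eq_sum_of_certs D D.f hF (basis S) tabs duals 12 (htabs S hs) hlen hdual
    (by norm_num) finrank_cuspForm_two stages (fun st hst ↦ (hps99 st hst).2) hrel certs hcover hpiv
  exact ⟨S, hS, c, hc, hc1.symm, hpin⟩

end Summit.BirchSwinnertonDyer.BirchSwinnertonDyer.Theorems.ManinLocalTwoThree.PinningNinetyNine

end
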